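import Literature.Probability.RandomPlanarGeometry.SAWCountZdFifthCoefficient
import HarnessLib

/-!
# The weighted shape census: leaf WEIGHTS instead of class indicators (grouped `1/d`-symbol counts as ONE kernel evaluation per break count)

Topic `Literature/Probability/RandomPlanarGeometry` (infrastructure for the «SYMBOL POLYNOMIALITY» programme: a-p3 g20's pruned depth-first census
`SAWPulledLargeForceExpansionZdWordSearch.lean` (`dfsV`/`dfsN`, ★ `dfsN_eq_card`, `dfsV_eq`, `dfsN_eq_of_table`), the shape census engine
`SAWCountZdShapeCensus.lean` (a-p1 g23: `shUpd`/`shOk`/`shCls`, ★★★ `card_shapeClass_adjOf`) and its assembly `SAWCountZdFifthCoefficient.lean`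
(`breaksN`, the grouped counts `M(u,b) = Σ_{c : breaks = b} #shapeClass_j(u, A_c)` that feed `symbolPoly j`)).

PRINTED CONTEXT (locators only). Madras–Slade (1993) Definition 1.2.4, §1.1 eq. (1.1.8) p. 5. The census machinery is the lane's.

WHY. In the class-indicator census the kernel visits every (leaf, class) pair — `2^{u−1}` classes per leaf; at `j = 5` (`u ≤ 10`, 512 classes,
≈ 30 000 reduced leaves) this exceeds the kernel budget (a-p1 g23 calibration, `HOME/pub-sawmu-a-p1/g23/eps5/`). The assembly only needs the counts
GROUPED BY THE NUMBER OF BREAKS `b ≤ u` — so the leaf should contribute a WEIGHT `wt b s ∈ ℕ` (the number of classes of break count `b` passing at the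
leaf) rather than `2^{u−1}` indicator digits. THIS FILE generalises a-p3's three census theorems from indicators to weights, verbatim in structure:
`dfsW` (the weighted count), `leafW`/`dfsVW` (its base-`B` encoding, what the kernel evaluates), `AdmW`; ★★ `dfsW_eq_sum` (the weighted counting
theorem: from a restricted-growth prefix the weighted count is the sum of the weights over the admissible completions), ★★ `sum_TL_weight_eq_dfsW`
(over the transversal `TL L`: `Σ_{τ canonical, policy, prefixes ok, k axes} wt b (st τ) = dfsW b k L s₀ 0`), ★ `dfsW_le` (a-priori bound
`W · (2(m+j))^j` from a weight bound `W`), ★ `dfsVW_eq` (the encoding identity), ★★ `dfsW_eq_of_table` (digit read-off), and the APPLICATION to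
shapes: `wtSh u b` (the number of adjacency codes `c < 2^{u−1}` with `breaksN u c = b` passing `shCls c`) and ★★★ `sum_card_shapeClass_eq_dfsW`:
`Σ_{c < 2^{u−1}, breaksN u c = b} #shapeClass_j(u, A_c) = 2^{u−j} · dfsW alwR (shUpd u) (shOk u (u−j)) (wtSh u) b (u−j) u shS0 0`. A faster weight
`wt'` with a lemma `wt' = wtSh u` (e.g. by inclusion–exclusion over the zero-block masks) then turns every grouped census `M_j(u, ·)` into one kernel
evaluation with `u + 1` digits per axis count. DEMONSTRATION: `dfsVW_six` (kernel, `u = 6`) and ★★ `sum_card_shapeClass_six` re-derive the grouped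
excess-four counts `M(6,·) = (96, 256, 192)` of `shM_eq_lit` by the weighted route. The definitions `dfsW`, `leafW`, `dfsVW`, `AdmW`, `rowW`, `wtSh`,
`wTab6` are this file's tool notions.
[cite: MadrasSlade1993, Definition 1.2.4; §1.1 eq. (1.1.8) p. 5]

Provenance: lane «pcv-sawmu», a-p1 g23 (2026-08-27).
-/

open Finset
open scoped BigOperators
open Literature.Probability.LatticeModels
open Literature.Probability.RandomPlanarGeometry.SAW
open Literature.Probability.Percolation

namespace Literature.Probability.RandomPlanarGeometry.SAW.Zd

namespace WordTypes

/-! ### Weighted search: definitions -/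

section wdefs

variable {S : Type*} (alw : ℕ → ℕ × Bool → Bool) (upd : S → ℕ × Bool → S) (ok : S → Bool) (wt : ℕ → S → ℕ)

/-- ★ The WEIGHTED pruned depth-first count: over the admissible completions with final axis count `k`, the sum of the leaf weights `wt b`.
[cite: MadrasSlade1993, Definition 1.2.4; lane tool notion] -/
def dfsW (b k : ℕ) : ℕ → S → ℕ → ℕ
  | 0, s, m => if ok s then (if m = k then wt b s else 0) else 0
  | j + 1, s, m => if ok s then (lts alw m).foldr (fun a acc => acc + dfsW b k j (upd s a) (nxt m a)) 0 else 0

/-- The weighted leaf value `Σ_{b < C} wt b s · B^(N b + m)`. [cite: MadrasSlade1993, Definition 1.2.4; lane tool notion] -/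
def leafW (C N B : ℕ) (s : S) (m : ℕ) : ℕ := (List.range C).foldr (fun b acc => acc + wt b s * B ^ (N * b + m)) 0

/-- ★ The base-`B` encoded weighted census (what the kernel evaluates). [cite: MadrasSlade1993, Definition 1.2.4; lane tool notion] -/
def dfsVW (C N B : ℕ) : ℕ → S → ℕ → ℕ
  | 0, s, m => if ok s then leafW wt C N B s m else 0
  | j + 1, s, m => if ok s then (lts alw m).foldr (fun a acc => acc + dfsVW C N B j (upd s a) (nxt m a)) 0 else 0

/-- The weighted row value: digits `dfsW b k`, `k ≤ L`, in base `B`. [cite: MadrasSlade1993, Definition 1.2.4; lane tool notion] -/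
def rowW (L B b j : ℕ) (s : S) (m : ℕ) : ℕ := ∑ k ∈ Finset.range (L + 1), dfsW alw upd ok wt b k j s m * B ^ k

end wdefs

/-! ### The weighted counting theorem -/

section wcount

variable {S : Type*} (alw : ℕ → ℕ × Bool → Bool) (upd : S → ℕ × Bool → S) (ok : S → Bool) (wt : ℕ → S → ℕ) (s₀ : S)

/-- Weight-admissible completions of the raw prefix `w` (restricted growth under the policy; every prefix at least as long as `w` passes `ok`;
`k` axes) — the class-free part of `Adm`. [cite: MadrasSlade1993, Definition 1.2.4; lane tool notion] -/
abbrev AdmW (L k : ℕ) (w : List (ℕ × Bool)) {j : ℕ} (v : Fin j → Idx L) : Prop :=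
  rgA alw 0 (xw w v) = true ∧ (∀ i : Fin (L + 1), w.length ≤ i.val → ok (st upd s₀ ((xw w v).take i.val)) = true) ∧ naxL 0 (xw w v) = k

/-- Summing over tuples of length `j+1` by their first entry. [cite: MadrasSlade1993, Definition 1.2.4; lane plumbing] -/
theorem sum_fin_succ_eq {X : Type*} [Fintype X] {j : ℕ} (F : (Fin (j + 1) → X) → ℕ) :
    ∑ v : Fin (j + 1) → X, F v = ∑ a : X, ∑ v : Fin j → X, F (Fin.cons a v) := by
  rw [← Fintype.sum_prod_type', ← (Fin.consEquiv fun _ : Fin (j + 1) => X).sum_comp]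
  rfl

open Classical in
/-- ★★ THE WEIGHTED COUNTING THEOREM: from a restricted-growth prefix `w` with `|w| + j = L`,
`dfsW b k j (st w) (naxL 0 w) = Σ_{v admissible} wt b (st (xw w v))`. [cite: MadrasSlade1993, Definition 1.2.4; lane theorem] -/
theorem dfsW_eq_sum (L b k : ℕ) : ∀ (j : ℕ) (w : List (ℕ × Bool)), rgA alw 0 w = true → w.length + j = L →
    dfsW alw upd ok wt b k j (st upd s₀ w) (naxL 0 w) =
      ∑ v : Fin j → Idx L, (if AdmW alw upd ok s₀ L k w v then wt b (st upd s₀ (xw w v)) else 0) := by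
  intro j
  induction j with
  | zero =>
    intro w hw hj
    rw [Fintype.sum_unique]
    unfold dfsW AdmW
    simp only [xw_zero]
    by_cases hok : ok (st upd s₀ w) = true
    · rw [if_pos hok]
      by_cases hk : naxL 0 w = k
      · rw [if_pos hk, if_pos]
        refine ⟨hw, fun i hi => ?_, hk⟩
        have : i.val = w.length := by have := i.isLt; omega
        rw [this, List.take_length]
        exact hok
      · rw [if_neg hk, if_neg fun h => hk h.2.2]
    · rw [if_neg hok, if_neg]
      rintro ⟨-, h, -⟩
      have := h ⟨w.length, by omega⟩ le_rfl
      rw [List.take_length] at this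
      exact hok this
  | succ j ih =>
    intro w hw hj
    rw [sum_fin_succ_eq]
    by_cases hok : ok (st upd s₀ w) = true
    · have hinner : ∀ a : Idx L,
          (∑ v : Fin j → Idx L, if AdmW alw upd ok s₀ L k w (Fin.cons a v : Fin (j + 1) → Idx L) then
              wt b (st upd s₀ (xw w (Fin.cons a v : Fin (j + 1) → Idx L))) else 0) =
          if a.1.val ≤ naxL 0 w ∧ alw (naxL 0 w) (raw a) = true then
            dfsW alw upd ok wt b k j (st upd s₀ (w ++ [raw a])) (nxt (naxL 0 w) (raw a)) else 0 := by
        intro a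
        by_cases ha : a.1.val ≤ naxL 0 w ∧ alw (naxL 0 w) (raw a) = true
        · rw [if_pos ha]
          have hw' : rgA alw 0 (w ++ [raw a]) = true := by
            rw [rgA_append_singleton, hw, Bool.true_and, Bool.and_eq_true, Nat.ble_eq]; exact ha
          rw [← naxL_append_singleton, ih (w ++ [raw a]) hw' (by simp; omega)]
          refine Finset.sum_congr rfl fun v _ => ?_
          unfold AdmW
          rw [xw_cons]
          refine if_congr ?_ rfl rfl
          refine ⟨fun h => ⟨h.1, fun i hi => h.2.1 i ?_, h.2.2⟩, fun h => ⟨h.1, fun i hi => ?_, h.2.2⟩⟩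
          · simp only [List.length_append, List.length_singleton] at hi; omega
          · rcases Nat.eq_or_lt_of_le hi with hi' | hi'
            · rw [← hi', xw_take_of_le _ _ (by simp), List.take_left]
              exact hok
            · exact h.2.1 i (by simp; omega)
        · rw [if_neg ha]
          refine Finset.sum_eq_zero fun v _ => ?_
          rw [if_neg]
          intro h
          apply ha
          unfold AdmW at h
          rw [xw_cons] at h
          have h1 := h.1
          unfold xw at h1
          rw [rgA_append, rgA_append_singleton, Bool.and_eq_true, Bool.and_eq_true, Bool.and_eq_true, Nat.ble_eq] at h1
          exact h1.1.2
      simp only [hinner]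
      have hmL : naxL 0 w + 1 ≤ L := by
        have := naxL_le 0 w (rgOK_of_rgA alw 0 w hw); simp only [Nat.zero_add] at this; omega
      have e := sum_idx_eq_foldr_lts alw hmL (fun r => dfsW alw upd ok wt b k j (st upd s₀ (w ++ [r])) (nxt (naxL 0 w) r))
      beta_reduce at e
      rw [e, dfsW, if_pos hok]
      simp only [st_append_singleton]
    · rw [dfsW, if_neg hok, eq_comm]
      refine Finset.sum_eq_zero fun a _ => Finset.sum_eq_zero fun v _ => ?_
      rw [if_neg]
      intro h
      apply hok
      have := h.2.1 ⟨w.length, by omega⟩ le_rfl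
      rwa [xw_take_of_le _ _ le_rfl, List.take_length] at this

open Classical in
/-- ★★ THE WEIGHTED CLASS SUM OVER THE TRANSVERSAL IS THE WEIGHTED DFS COUNT: over the canonical words all of whose prefixes pass `ok`, written under
the policy `alw`, with `k` axes, the leaf weights sum to `dfsW b k L s₀ 0`. [cite: MadrasSlade1993, Definition 1.2.4; lane theorem] -/
theorem sum_TL_weight_eq_dfsW {L : ℕ} (b k : ℕ) :
    ∑ τ ∈ ((TL L).filter fun τ => rgA alw 0 (rawW τ) = true ∧ PrefixOK upd ok s₀ τ ∧ numAxes τ = k), wt b (st upd s₀ (rawW τ)) =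
      dfsW alw upd ok wt b k L s₀ 0 := by
  have h := dfsW_eq_sum alw upd ok wt s₀ L b k L [] rfl (by simp)
  rw [naxL] at h
  change dfsW alw upd ok wt b k L s₀ 0 = _ at h
  have hx : ∀ τ : Word L L, xw [] τ = rawW τ := by intro τ; unfold xw rawW; simp
  rw [h]
  unfold TL
  rw [Finset.filter_filter, Finset.sum_filter]
  refine Finset.sum_congr rfl fun τ _ => ?_
  by_cases hA : AdmW alw upd ok s₀ L k [] τ
  · have hrg : rgA alw 0 (rawW τ) = true := by rw [← hx]; exact hA.1
    have hg : GrowthOK τ := (growthOK_iff_rgOK τ).2 (rgOK_of_rgA alw 0 _ hrg)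
    rw [if_pos hA, if_pos, hx]
    refine ⟨(growthOK_iff_canon_eq τ).1 hg, hrg, fun i => ?_, ?_⟩
    · rw [← hx]; exact hA.2.1 i (Nat.zero_le _)
    · rw [numAxes_eq_naxL τ hg.axFixed, ← hx]; exact hA.2.2
  · rw [if_neg hA, if_neg]
    rintro ⟨hc, hrg, hpre, hk⟩
    apply hA
    have hg : GrowthOK τ := (growthOK_iff_canon_eq τ).2 hc
    refine ⟨by rw [hx]; exact hrg, fun i _ => by rw [hx]; exact hpre i, ?_⟩
    rw [hx, ← numAxes_eq_naxL τ hg.axFixed]; exact hk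

end wcount

/-! ### The encoding and the digit read-off (weighted) -/

section wdigits

variable {S : Type*} (alw : ℕ → ℕ × Bool → Bool) (upd : S → ℕ × Bool → S) (ok : S → Bool) (wt : ℕ → S → ℕ)

/-- ★ A-PRIORI BOUND: with weights bounded by `W`, `dfsW b k j s m ≤ W · (2(m + j))^j`. [cite: MadrasSlade1993, Definition 1.2.4; lane lemma] -/
theorem dfsW_le {W : ℕ} (hW : ∀ b s, wt b s ≤ W) (b k : ℕ) :
    ∀ (j : ℕ) (s : S) (m : ℕ), dfsW alw upd ok wt b k j s m ≤ W * (2 * (m + j)) ^ j := by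
  intro j
  induction j with
  | zero => intro s m; unfold dfsW; split_ifs <;> simp [hW]
  | succ j ih =>
    intro s m
    unfold dfsW
    split_ifs
    · refine le_trans (foldr_add_le _ _ (W * (2 * (m + (j + 1))) ^ j) fun a ha => ?_) ?_
      · refine le_trans (ih _ _) (Nat.mul_le_mul_left _ (Nat.pow_le_pow_left ?_ _))
        have := nxt_le (mem_lts alw ha).1
        omega
      · have hl : (lts alw m).length ≤ 2 * (m + (j + 1)) := (length_lts_le alw m).trans (by omega)
        calc (lts alw m).length * (W * (2 * (m + (j + 1))) ^ j)
            ≤ (2 * (m + (j + 1))) * (W * (2 * (m + (j + 1))) ^ j) := Nat.mul_le_mul_right _ hl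
          _ = W * (2 * (m + (j + 1))) ^ (j + 1) := by ring
    · exact Nat.zero_le _

/-- The weighted leaf value in table form (for `m ≤ L`). [cite: MadrasSlade1993, Definition 1.2.4; lane plumbing] -/
theorem leafW_eq (C L B : ℕ) (s : S) {m : ℕ} (hm : m ≤ L) :
    leafW wt C (L + 1) B s m =
      ∑ b ∈ Finset.range C, (∑ k ∈ Finset.range (L + 1), (if m = k then wt b s else 0) * B ^ k) * (B ^ (L + 1)) ^ b := by
  have hrow : ∀ b, ∑ k ∈ Finset.range (L + 1), (if m = k then wt b s else 0) * B ^ k = wt b s * B ^ m := by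
    intro b
    rw [Finset.sum_eq_single_of_mem m (Finset.mem_range.2 (Nat.lt_succ_of_le hm))]
    · rw [if_pos rfl]
    · intro k _ hk
      rw [if_neg fun h => hk h.symm, zero_mul]
  simp only [hrow]
  unfold leafW
  rw [foldr_add_eq_sum, ← List.sum_toFinset _ (List.nodup_range), List.toFinset_range]
  refine Finset.sum_congr rfl fun b _ => ?_
  rw [← pow_mul, mul_assoc, ← pow_add, Nat.add_comm, Nat.mul_comm (L + 1)]

/-- ★ THE WEIGHTED ENCODING IDENTITY (valid while `m + j ≤ L`). [cite: MadrasSlade1993, Definition 1.2.4; lane lemma] -/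
theorem dfsVW_eq (C L B : ℕ) : ∀ (j : ℕ) (s : S) (m : ℕ), m + j ≤ L →
    dfsVW alw upd ok wt C (L + 1) B j s m = ∑ b ∈ Finset.range C, rowW alw upd ok wt L B b j s m * (B ^ (L + 1)) ^ b := by
  intro j
  induction j with
  | zero =>
    intro s m hm
    unfold dfsVW rowW dfsW
    by_cases hok : ok s = true
    · simp only [hok, if_true]
      exact leafW_eq wt C L B s (by simpa using hm)
    · simp [hok]
  | succ j ih =>
    intro s m hm
    unfold dfsVW rowW
    by_cases hok : ok s = true
    · simp only [hok, if_true]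
      have hbranch : ∀ a ∈ lts alw m, dfsVW alw upd ok wt C (L + 1) B j (upd s a) (nxt m a) =
          ∑ b ∈ Finset.range C, (∑ k ∈ Finset.range (L + 1), dfsW alw upd ok wt b k j (upd s a) (nxt m a) * B ^ k) * (B ^ (L + 1)) ^ b := by
        intro a ha
        have : nxt m a + j ≤ L := by have := nxt_le (mem_lts alw ha).1; omega
        rw [ih _ _ this]
        rfl
      rw [foldr_add_congr _ _ _ hbranch, foldr_add_finset_sum]
      refine Finset.sum_congr rfl fun b _ => ?_
      rw [foldr_add_mul, foldr_add_finset_sum]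
      simp only [dfsW, hok, if_true]
      congr 1
      refine Finset.sum_congr rfl fun k _ => ?_
      rw [foldr_add_mul]
    · simp only [hok]
      rw [eq_comm]
      refine Finset.sum_eq_zero fun b _ => ?_
      rw [Finset.sum_eq_zero fun k _ => ?_, zero_mul]
      rw [dfsW, if_neg hok, zero_mul]

/-- ★★ THE WEIGHTED DIGITS: if `dfsVW … C (L+1) B L s₀ 0 = Nat.ofDigits (B^(L+1)) (rows of ns)` for a table `ns` of `C` rows of `L+1` entries `< B`,
and `W · (2L)^L < B` for a weight bound `W`, then every weighted count `dfsW … b k L s₀ 0` IS the table entry. [cite: MadrasSlade1993, Definition 1.2.4; lane theorem] -/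
theorem dfsW_eq_of_table {C L B W : ℕ} (s₀ : S) (hW : ∀ b s, wt b s ≤ W) (hB : W * (2 * L) ^ L < B) (ns : List (List ℕ)) (hC : ns.length = C)
    (hlen : ∀ r ∈ ns, r.length = L + 1) (hlt : ∀ r ∈ ns, ∀ x ∈ r, x < B)
    (hV : dfsVW alw upd ok wt C (L + 1) B L s₀ 0 = Nat.ofDigits (B ^ (L + 1)) (ns.map (Nat.ofDigits B)))
    {b k : ℕ} (hb : b < C) (hk : k ≤ L) : dfsW alw upd ok wt b k L s₀ 0 = (ns.getD b []).getD k 0 := by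
  set rows : List (List ℕ) := (List.range C).map fun b => (List.range (L + 1)).map fun k => dfsW alw upd ok wt b k L s₀ 0 with hrows
  have hdig : ∀ b' k', dfsW alw upd ok wt b' k' L s₀ 0 < B := fun b' k' =>
    lt_of_le_of_lt (by simpa using dfsW_le alw upd ok wt hW b' k' L s₀ 0) hB
  have hrowlt : ∀ r ∈ rows, Nat.ofDigits B r < B ^ (L + 1) := by
    intro r hr
    obtain ⟨b', -, rfl⟩ := List.mem_map.1 hr
    have := ofDigits_lt_pow_length (b := B) ((List.range (L + 1)).map fun k => dfsW alw upd ok wt b' k L s₀ 0)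
      (fun x hx => by obtain ⟨k', -, rfl⟩ := List.mem_map.1 hx; exact hdig _ _)
    simpa using this
  have hval : dfsVW alw upd ok wt C (L + 1) B L s₀ 0 = Nat.ofDigits (B ^ (L + 1)) (rows.map (Nat.ofDigits B)) := by
    rw [dfsVW_eq alw upd ok wt C L B L s₀ 0 (by simp), hrows, List.map_map, ← sum_mul_pow_eq_ofDigits]
    refine Finset.sum_congr rfl fun b' _ => ?_
    unfold rowW
    rw [sum_mul_pow_eq_ofDigits]
    rfl
  have houter : rows.map (Nat.ofDigits B) = ns.map (Nat.ofDigits B) := by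
    refine ofDigits_inj_of_length_eq _ _ (by simp [hrows, hC]) ?_ ?_ (hval.symm.trans hV)
    · intro x hx
      obtain ⟨r, hr, rfl⟩ := List.mem_map.1 hx
      exact hrowlt r hr
    · intro x hx
      obtain ⟨r, hr, rfl⟩ := List.mem_map.1 hx
      have := ofDigits_lt_pow_length r (hlt r hr)
      rwa [hlen r hr] at this
  have hcR : b < rows.length := by simp [hrows, hb]
  have hcN : b < ns.length := by rw [hC]; exact hb
  have hrowc : Nat.ofDigits B (rows[b]'hcR) = Nat.ofDigits B (ns[b]'hcN) := by
    have := congrArg (fun l => l[b]?) houter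
    simp only [List.getElem?_map, List.getElem?_eq_getElem hcR, List.getElem?_eq_getElem hcN, Option.map_some] at this
    exact Option.some.inj this
  have hrc : rows[b]'hcR = (List.range (L + 1)).map fun k => dfsW alw upd ok wt b k L s₀ 0 := by simp [hrows]
  have heqrow : rows[b]'hcR = ns[b]'hcN := by
    refine ofDigits_inj_of_length_eq _ _ ?_ ?_ (hlt _ (List.getElem_mem hcN)) hrowc
    · rw [hrc, hlen _ (List.getElem_mem hcN)]; simp
    · rw [hrc]; intro x hx; obtain ⟨k', -, rfl⟩ := List.mem_map.1 hx; exact hdig _ _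
  have hget : (ns.getD b []) = rows[b]'hcR := by
    rw [heqrow, List.getD_eq_getElem?_getD, List.getElem?_eq_getElem hcN, Option.getD_some]
  rw [hget, hrc, List.getD_eq_getElem?_getD, List.getElem?_map, List.getElem?_range (Nat.lt_succ_of_le hk)]
  rfl

end wdigits

/-! ### Application: grouped shape counts as one weighted census -/

section wshapes

/-- The shape WEIGHT of break count `b` at a search state: the number of adjacency codes `c < 2^{u−1}` with `breaksN u c = b` whose class test passes.
(Brute force; a faster equal weight can be substituted via `sum_card_shapeClass_eq_dfsW`.) [cite: MadrasSlade1993, Definition 1.2.4; lane tool notion] -/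
def wtSh (u : ℕ) (b : ℕ) (s : ShSt) : ℕ := ((List.range (2 ^ (u - 1))).filter fun c => breaksN u c == b && shCls c s).length

/-- The shape weight is at most `2^{u−1}`. [cite: MadrasSlade1993, Definition 1.2.4; lane plumbing] -/
theorem wtSh_le (u b : ℕ) (s : ShSt) : wtSh u b s ≤ 2 ^ (u - 1) := by
  unfold wtSh
  exact (List.length_filter_le _ _).trans (by simp)

/-- The shape weight as a finite sum of class indicators. [cite: MadrasSlade1993, Definition 1.2.4; lane plumbing] -/
theorem wtSh_eq_sum (u b : ℕ) (s : ShSt) :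
    wtSh u b s = ∑ c ∈ Finset.range (2 ^ (u - 1)), (if breaksN u c = b ∧ shCls c s = true then 1 else 0) := by
  unfold wtSh
  rw [← List.countP_eq_length_filter, countP_eq_sum_map_ite, sum_map_range]
  refine Finset.sum_congr rfl fun c _ => ?_
  simp only [Bool.and_eq_true, beq_iff_eq]

/-- Weighted counts do not depend on weights the search never distinguishes: congruence in the weight function.
[cite: MadrasSlade1993, Definition 1.2.4; lane plumbing] -/
theorem dfsW_congr_wt {S : Type*} (alw : ℕ → ℕ × Bool → Bool) (upd : S → ℕ × Bool → S) (ok : S → Bool) {wt wt' : ℕ → S → ℕ}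
    (h : ∀ b s, wt b s = wt' b s) (b k : ℕ) : ∀ (j : ℕ) (s : S) (m : ℕ), dfsW alw upd ok wt b k j s m = dfsW alw upd ok wt' b k j s m := by
  intro j
  induction j with
  | zero => intro s m; unfold dfsW; rw [h]
  | succ j ih => intro s m; unfold dfsW; simp only [ih]

open Classical in
/-- ★★★ THE GROUPED SHAPE COUNTS AS ONE WEIGHTED CENSUS: for `j ≤ u`,
`Σ_{c < 2^{u−1}, breaksN u c = b} #shapeClass_j(u, A_c) = 2^{u−j} · dfsW alwR (shUpd u) (shOk u (u−j)) (wtSh u) b (u−j) u shS0 0`.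
[cite: MadrasSlade1993, Definition 1.2.4; §1.1 eq. (1.1.8) p. 5; lane theorem] -/
theorem sum_card_shapeClass_eq_dfsW (j u b : ℕ) (hju : j ≤ u) :
    ∑ c ∈ Finset.range (2 ^ (u - 1)), (if breaksN u c = b then (shapeClass j u (adjOf u c)).card else 0) =
      2 ^ (u - j) * dfsW alwR (shUpd u) (shOk u (u - j)) (wtSh u) b (u - j) u shS0 0 := by
  -- each class count is a class-indicator census over the class-free transversal filter `T`
  set T := (TL u).filter fun τ => rgA alwR 0 (rawW τ) = true ∧ PrefixOK (shUpd u) (shOk u (u - j)) shS0 τ ∧ numAxes τ = u - j with hT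
  have hclass : ∀ c, (shapeClass j u (adjOf u c)).card =
      2 ^ (u - j) * ∑ τ ∈ T, (if shCls c (st (shUpd u) shS0 (rawW τ)) = true then 1 else 0) := by
    intro c
    rw [card_shapeClass_adjOf j u c hju, ← card_TL_class alwR (shUpd u) (shOk u (u - j)) shCls shS0 c (u - j),
      ← Finset.card_filter, hT, Finset.filter_filter, Finset.filter_filter]
    congr 2
    exact Finset.filter_congr fun τ _ => by tauto
  have hlhs : ∀ c ∈ Finset.range (2 ^ (u - 1)), (if breaksN u c = b then (shapeClass j u (adjOf u c)).card else 0) =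
      2 ^ (u - j) * ∑ τ ∈ T, (if breaksN u c = b ∧ shCls c (st (shUpd u) shS0 (rawW τ)) = true then 1 else 0) := by
    intro c _
    rw [hclass c]
    by_cases hb : breaksN u c = b
    · rw [if_pos hb]
      congr 1
      refine Finset.sum_congr rfl fun τ _ => ?_
      by_cases hc : shCls c (st (shUpd u) shS0 (rawW τ)) = true
      · rw [if_pos hc, if_pos ⟨hb, hc⟩]
      · rw [if_neg hc, if_neg fun h => hc h.2]
    · rw [if_neg hb, eq_comm, Nat.mul_eq_zero]
      right
      exact Finset.sum_eq_zero fun τ _ => by rw [if_neg fun h => hb h.1]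
  rw [Finset.sum_congr rfl hlhs, ← Finset.mul_sum, Finset.sum_comm,
    ← sum_TL_weight_eq_dfsW alwR (shUpd u) (shOk u (u - j)) (wtSh u) shS0 b (u - j), ← hT]
  congr 1
  exact Finset.sum_congr rfl fun τ _ => (wtSh_eq_sum u b _).symm

end wshapes

/-! ### Demonstration cell: the grouped excess-four counts at `u = 6` by the weighted route -/

section wdemo

/-- Weighted census table at `u = 6`, `j = 4` (rows = break count `b < 7`, columns = axes `k ≤ 6`): the reduced grouped counts `(24, 64, 48)` at
`k = 2`. [cite: MadrasSlade1993, Definition 1.2.4; lane census] -/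
def wTab6 : List (List ℕ) :=
  [[0, 0, 0, 0, 0, 0, 0], [0, 0, 24, 0, 0, 0, 0], [0, 0, 64, 0, 0, 0, 0], [0, 0, 48, 0, 0, 0, 0], [0, 0, 0, 0, 0, 0, 0],
    [0, 0, 0, 0, 0, 0, 0], [0, 0, 0, 0, 0, 0, 0]]

/-- ★ KERNEL CELL (weighted, `u = 6`): ONE evaluation with `7` break-count rows replaces the `32` class rows of `shV_six`.
[cite: MadrasSlade1993, Definition 1.2.4; lane census] -/
theorem dfsVW_six : dfsVW alwR (shUpd 6) (shOk 6 2) (wtSh 6) 7 7 (2 ^ 33) 6 shS0 0 =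
    Nat.ofDigits ((2 ^ 33) ^ 7) (wTab6.map (Nat.ofDigits (2 ^ 33))) := by
  decide +kernel

/-- ★★ THE GROUPED EXCESS-FOUR COUNTS AT `u = 6` BY THE WEIGHTED ROUTE: `Σ_{c : breaks = b} #shapeClass_4(6, A_c) = 4 · (0, 24, 64, 48, 0, 0, 0)_b`
(`b < 7`) — i.e. `M(6, ·) = (96, 256, 192)` of `SAWCountZdFifthCoefficient.shM_eq_lit`, re-derived through `sum_card_shapeClass_eq_dfsW` (consistency
of the two census routes, both kernel facts). [cite: MadrasSlade1993, Definition 1.2.4; §1.1 eq. (1.1.8) p. 5; lane census] -/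
theorem sum_card_shapeClass_six (b : ℕ) (hb : b < 7) :
    ∑ c ∈ Finset.range (2 ^ (6 - 1)), (if breaksN 6 c = b then (shapeClass 4 6 (adjOf 6 c)).card else 0) =
      4 * ((wTab6.getD b []).getD 2 0) := by
  rw [sum_card_shapeClass_eq_dfsW 4 6 b (by norm_num)]
  have h := dfsW_eq_of_table alwR (shUpd 6) (shOk 6 (6 - 4)) (wtSh 6) (C := 7) (L := 6) (B := 2 ^ 33) (W := 2 ^ (6 - 1)) shS0
    (wtSh_le 6) (by norm_num) wTab6 rfl (by decide) (by decide) dfsVW_six hb (by norm_num : 6 - 4 ≤ 6)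
  rw [h]
  norm_num

end wdemo

end WordTypes

end Literature.Probability.RandomPlanarGeometry.SAW.Zd
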